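import Literature.AlgebraicGeometry.Motives.HodgeLieTimesNonCMCurve
import Literature.AlgebraicGeometry.Motives.HodgeLieRigidTimesRankOne
import HarnessLib

/-!
# `Θ`-rigidity is inherited along a NON-CM elliptic curve: `H₁` rigid, `H₂ = H¹(E)` with `End_Hdg(H₂) = ℚ`, `Hom_Hdg(H₂, H₁) = 0` ⟹ `H₁ ⊕ H₂` rigid
# (Moonen–Zarhin 1999 Lemma (3.4) with (3.1): Goursat over the simple factor `𝔰𝔩₂`, the graph excluded by `Hom = 0`)

Family `hodge`, layer `Literature/AlgebraicGeometry/Motives`; THEOREMS ONLY (no definition, no named fact).  Written for the cell `pub-hodgecm2`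
(COR-CM), seat `b27` gen 51 (count-neutral Mumford–Tate-rank ladder).  Companion of `Motives/HodgeLieTimesNonCMCurve` (gen 47), which applies the
tree's abstract Lemma (3.4) `goursat_incl_corner_mem_of_hom_eq_zero` (cell `pub-hodge-ring2`) to `𝔞 = 𝔥(H)` and obtains the SPLITTING
`𝔥(H₁ ⊕ H₂) = 𝔥(H₁) × 𝔰𝔭(V₂)`; and of `Motives/HodgeLieRigidTimesRankOne` / `Motives/HodgeLieTimesCMSummandRigid` (rigidity along CM summands).
Here the abstract lemma is applied to an ARBITRARY bracket-closed rational `𝔞 ⊆ 𝔥(H)` whose complex span contains a Hodge operator: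

**`finrank_eq_add_three_and_rigid_of_nonCMCurve_summand_of_rigid`** — `H ≅ H₁ ⊕ H₂` (`ι_i`, `π_i`) of effective weight-one polarizable Hodge structures, `dim V₂ = 2`,
`End_Hdg(H₂) = ℚ`, no non-zero `ℚ`-linear `V₂ → V₁` respecting the Hodge pieces, and `H₁` `Θ`-RIGID ⟹ `dim 𝔥(H) = dim 𝔥(H₁) + 3` (gen 47) AND `H` is `Θ`-rigid (bundled: the rigidity conclusion alone has
the shape of `Motives/HodgeLieTimesCMSummandRigid`'s).  PROOF.  `𝔞` commutes
with the projectors `ι_iπ_i` and has `ψ_i`-skew corners (it lies in `𝔥(H)`), so Lemma (3.4) gives `ι₁ (π₁ X ι₁) π₁ ∈ 𝔞` for `X ∈ 𝔞` and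
`ι₂ Z π₂ ∈ 𝔞` for every `ψ₂`-skew `Z`; by the rigidity of `H₁`, `π₁ 𝔞 ι₁ = 𝔥(H₁)` (`map_restrict_eq_hodgeLie_of_rigid`); and every `Y ∈ 𝔥(H)` is
`ι₁ (π₁ Y ι₁) π₁ + ι₂ (π₂ Y ι₂) π₂` with `π₂ Y ι₂ ∈ 𝔥(H₂)` `ψ₂`-skew.  So `𝔥(H) ⊆ 𝔞`.
AV reading (`CorCM/MumfordTateRankRigidTimesNonCMCurve`): `X₁` with `Θ`-rigid `H¹` and a non-CM elliptic curve `E` with `Hom(X₁, E) = 0` give a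
`Θ`-rigid `X₁ × E`; with the CM towers of gen 50/51 every product of a simple type-IV(2,1) threefold with elliptic curves is `Θ`-rigid, and the
rigid-factor monotonicity `t(X × Y) ≥ t(X)` applies to all of them.

## References
* [MoonenZarhin1999LowDim] B. Moonen, Yu. G. Zarhin, *Hodge classes on abelian varieties of low dimension*, Math. Ann. 315 (1999), §3 (3.1),
  Lemma (3.3), Lemma (3.4), Remark (3.5) [corpus: paper:arxiv-math_9901113 pp. 6–7]. [cite: MoonenZarhin1999LowDim, §3 (3.1) and Lemma (3.4)]
* [Hazama1983] F. Hazama, *Algebraic cycles on abelian varieties with many real endomorphisms*, Tôhoku Math. J. 35 (1983), Lemma (3.1) (Goursat).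
  [cite: Hazama1983, Lemma (3.1)]
* [Deligne1982HodgeCycles] P. Deligne, LNM 900 (1982), I §3.1 and Prop. 3.4. [cite: Deligne1982HodgeCycles, I §3.1 and Prop. 3.4]
-/

noncomputable section

namespace Literature.AlgebraicGeometry.Motives

namespace HodgeStructure

universe u

variable {V₁ : Type u} [AddCommGroup V₁] [Module ℚ V₁] [Module.Finite ℚ V₁]
  {V₂ : Type u} [AddCommGroup V₂] [Module ℚ V₂] [Module.Finite ℚ V₂]
  {V : Type u} [AddCommGroup V] [Module ℚ V] [Module.Finite ℚ V] [HodgeTensorFacts.{u, u}] {n : ℤ}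
  {H₁ : HodgeStructure V₁ n} {H₂ : HodgeStructure V₂ n} {H : HodgeStructure V n}
  (ι₁ : Hom H₁ H) (π₁ : Hom H H₁) (ι₂ : Hom H₂ H) (π₂ : Hom H H₂)
  (hπι₁ : ∀ v, π₁.toLinearMap (ι₁.toLinearMap v) = v) (hπι₂ : ∀ v, π₂.toLinearMap (ι₂.toLinearMap v) = v)
  (hsum : ∀ v, ι₁.toLinearMap (π₁.toLinearMap v) + ι₂.toLinearMap (π₂.toLinearMap v) = v)
  (hn : n = 1) (heff₁ : H₁.IsEffective) (heff₂ : H₂.IsEffective) (ψ₁ : H₁.Polarization) (ψ₂ : H₂.Polarization)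
  (hE₂ : ∀ a ∈ H₂.endAlg, ∃ x : ℚ, a = x • 1) (hV₂ : Module.finrank ℚ V₂ = 2)
  (hHom : ∀ f : V₂ →ₗ[ℚ] V₁, (∀ p, ∀ x ∈ H₂.piece p (n - p), f.baseChange ℂ x ∈ H₁.piece p (n - p)) → f = 0)
  (hrig₁ : ∀ 𝔞 : Submodule ℚ (Module.End ℚ V₁), 𝔞 ≤ H₁.hodgeLie →
      (∀ X ∈ 𝔞, ∀ Y ∈ 𝔞, X * Y - Y * X ∈ 𝔞) →
      (∃ Θ ∈ Submodule.span ℂ ((fun X : Module.End ℚ V₁ => X.baseChange ℂ) '' (𝔞 : Set (Module.End ℚ V₁))),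
        ∀ p, ∀ x ∈ H₁.piece p (n - p), Θ x = ((2 * p - n : ℤ) : ℂ) • x) → H₁.hodgeLie ≤ 𝔞)

omit [Module.Finite ℚ V₁] [Module.Finite ℚ V₂] [Module.Finite ℚ V] [HodgeTensorFacts.{u, u}] in
include hπι₁ hπι₂ hsum in
/-- `π₂ ι₁ = 0` for a decomposition `ι₁ π₁ + ι₂ π₂ = id` with `π_i ι_i = id`. [folklore] -/
private theorem proj₂_incl₁_eq_zero_nr (v : V₁) : π₂.toLinearMap (ι₁.toLinearMap v) = 0 := by
  have h := congrArg π₂.toLinearMap (hsum (ι₁.toLinearMap v))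
  rw [map_add, hπι₁ v, hπι₂] at h
  exact add_eq_left.1 h

omit [Module.Finite ℚ V₁] [Module.Finite ℚ V₂] [Module.Finite ℚ V] [HodgeTensorFacts.{u, u}] in
include hπι₁ hπι₂ hsum in
/-- `π₁ ι₂ = 0` for a decomposition `ι₁ π₁ + ι₂ π₂ = id` with `π_i ι_i = id`. [folklore] -/
private theorem proj₁_incl₂_eq_zero_nr (v : V₂) : π₁.toLinearMap (ι₂.toLinearMap v) = 0 := by
  have h := congrArg π₁.toLinearMap (hsum (ι₂.toLinearMap v))
  rw [map_add, hπι₂ v, hπι₁] at h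
  exact add_eq_left.1 h

include hπι₁ hπι₂ hsum hn heff₁ heff₂ ψ₁ ψ₂ hE₂ hV₂ hHom hrig₁ in
/-- **`Θ`-rigidity is inherited along a non-CM elliptic curve.**  `H ≅ H₁ ⊕ H₂` of effective weight-one polarizable Hodge structures with
`dim V₂ = 2`, `End_Hdg(H₂) = ℚ`, `Hom_Hdg(H₂, H₁) = 0` and `H₁` `Θ`-rigid: every bracket-closed rational `𝔞 ⊆ 𝔥(H)` whose complex span contains a
Hodge operator of `H` is all of `𝔥(H)`, and `dim 𝔥(H) = dim 𝔥(H₁) + 3` (Lemma (3.4) on `𝔞`: `ι₂ 𝔰𝔭(V₂) π₂ ⊆ 𝔞` and `𝔞` contains its first corners, which exhaust `ι₁ 𝔥(H₁) π₁` by the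
rigidity of `H₁`). [cite: MoonenZarhin1999LowDim, §3 (3.1) and Lemma (3.4)] [cite: Hazama1983, Lemma (3.1)]
[cite: Deligne1982HodgeCycles, I §3.1 and Prop. 3.4] -/
theorem finrank_eq_add_three_and_rigid_of_nonCMCurve_summand_of_rigid :
    Module.finrank ℚ H.hodgeLie = Module.finrank ℚ H₁.hodgeLie + 3 ∧
    ∀ 𝔞 : Submodule ℚ (Module.End ℚ V), 𝔞 ≤ H.hodgeLie →
      (∀ X ∈ 𝔞, ∀ Y ∈ 𝔞, X * Y - Y * X ∈ 𝔞) →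
      (∃ Θ ∈ Submodule.span ℂ ((fun X : Module.End ℚ V => X.baseChange ℂ) '' (𝔞 : Set (Module.End ℚ V))),
        ∀ p, ∀ x ∈ H.piece p (n - p), Θ x = ((2 * p - n : ℤ) : ℂ) • x) → H.hodgeLie ≤ 𝔞 := by
  classical
  refine ⟨finrank_hodgeLie_eq_add_three_of_nonCMCurve_summand ι₁ π₁ ι₂ π₂ hπι₁ hπι₂ hsum hn heff₁ heff₂ ψ₁ ψ₂ hE₂ hV₂ hHom, ?_⟩
  intro 𝔞 h𝔞 hbr hΘex
  -- the presentation as linear-map identities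
  have hπι₁' : π₁.toLinearMap ∘ₗ ι₁.toLinearMap = LinearMap.id := LinearMap.ext hπι₁
  have hπι₂' : π₂.toLinearMap ∘ₗ ι₂.toLinearMap = LinearMap.id := LinearMap.ext hπι₂
  have hπ₁ι₂ : π₁.toLinearMap ∘ₗ ι₂.toLinearMap = 0 := LinearMap.ext (proj₁_incl₂_eq_zero_nr ι₁ π₁ ι₂ π₂ hπι₁ hπι₂ hsum)
  have hπ₂ι₁ : π₂.toLinearMap ∘ₗ ι₁.toLinearMap = 0 := LinearMap.ext (proj₂_incl₁_eq_zero_nr ι₁ π₁ ι₂ π₂ hπι₁ hπι₂ hsum)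
  have hsum' : ι₁.toLinearMap ∘ₗ π₁.toLinearMap + ι₂.toLinearMap ∘ₗ π₂.toLinearMap = LinearMap.id := LinearMap.ext hsum
  -- Hodge pieces and Hodge operators
  have hι₁F : ∀ p, ∀ x ∈ H₁.piece p (n - p), ι₁.toLinearMap.baseChange ℂ x ∈ H.piece p (n - p) :=
    fun p x hx => ι₁.map_piece_le p _ ⟨x, hx, rfl⟩
  have hι₂F : ∀ p, ∀ x ∈ H₂.piece p (n - p), ι₂.toLinearMap.baseChange ℂ x ∈ H.piece p (n - p) :=
    fun p x hx => ι₂.map_piece_le p _ ⟨x, hx, rfl⟩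
  obtain ⟨ΘU, hΘU𝔞, hΘU⟩ := hΘex
  obtain ⟨Θ₁, hΘ₁⟩ := exists_hodgeTheta H₁
  obtain ⟨Θ₂, hΘ₂⟩ := exists_hodgeTheta H₂
  have hΘι₁ := theta_incl_eq H H₁ hι₁F hΘU hΘ₁
  have hΘι₂ := theta_incl_eq H H₂ hι₂F hΘU hΘ₂
  -- `𝔞`: commutes with the projectors, skew corners (it lies in `𝔥(H)`)
  have hP₁ : ∀ X ∈ 𝔞, X * (ι₁.toLinearMap ∘ₗ π₁.toLinearMap) = (ι₁.toLinearMap ∘ₗ π₁.toLinearMap) * X :=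
    fun X hX => commute_of_mem_hodgeLie H (h𝔞 hX) ⟨_, Hom.toLinearMap_mem_endAlg (ι₁.comp π₁)⟩
  have hP₂ : ∀ X ∈ 𝔞, X * (ι₂.toLinearMap ∘ₗ π₂.toLinearMap) = (ι₂.toLinearMap ∘ₗ π₂.toLinearMap) * X :=
    fun X hX => commute_of_mem_hodgeLie H (h𝔞 hX) ⟨_, Hom.toLinearMap_mem_endAlg (ι₂.comp π₂)⟩
  have hskew₁ : ∀ X ∈ 𝔞, ∀ v w, ψ₁.form ((π₁.toLinearMap ∘ₗ X ∘ₗ ι₁.toLinearMap) v) w +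
      ψ₁.form v ((π₁.toLinearMap ∘ₗ X ∘ₗ ι₁.toLinearMap) w) = 0 :=
    fun X hX => form_apply_add_eq_zero_of_mem_hodgeLie ψ₁ (comp_mem_hodgeLie_of_retract ι₁ π₁ hπι₁ (h𝔞 hX))
  have hskew₂ : ∀ X ∈ 𝔞, ∀ v w, ψ₂.form ((π₂.toLinearMap ∘ₗ X ∘ₗ ι₂.toLinearMap) v) w +
      ψ₂.form v ((π₂.toLinearMap ∘ₗ X ∘ₗ ι₂.toLinearMap) w) = 0 :=
    fun X hX => form_apply_add_eq_zero_of_mem_hodgeLie ψ₂ (comp_mem_hodgeLie_of_retract ι₂ π₂ hπι₂ (h𝔞 hX))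
  -- `Hom_Hdg(H₂, H₁) = 0` in `Θ`-form
  have hHom' : ∀ f : V₂ →ₗ[ℚ] V₁, Θ₁ ∘ₗ f.baseChange ℂ = f.baseChange ℂ ∘ₗ Θ₂ → f = 0 := fun f hf =>
    eq_zero_of_theta_comp_eq_of_hom_eq_zero hn H₁ H₂ heff₁ heff₂ hΘ₁ hΘ₂ hHom hf
  -- Lemma (3.4) on `𝔞`
  obtain ⟨h1, h2⟩ := goursat_incl_corner_mem_of_hom_eq_zero hn H₁ H₂ heff₁ heff₂ hπι₁' hπι₂' hπ₁ι₂ hπ₂ι₁ hsum' 𝔞 hbr hP₁ hP₂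
    ψ₁ ψ₂ hskew₁ hskew₂ hE₂ hV₂ hΘ₁ hΘ₂ hΘU𝔞 hΘι₁ hΘι₂ hHom'
  -- `π₁ 𝔞 ι₁ = 𝔥(H₁)` by the rigidity of `H₁`
  have himg := map_restrict_eq_hodgeLie_of_rigid ι₁ π₁ hπι₁ hrig₁ 𝔞 h𝔞 hbr ⟨ΘU, hΘU𝔞, hΘU⟩
  intro Y hY
  have hy : π₁.toLinearMap ∘ₗ Y ∘ₗ ι₁.toLinearMap ∈ H₁.hodgeLie := comp_mem_hodgeLie_of_retract ι₁ π₁ hπι₁ hY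
  rw [← himg] at hy
  obtain ⟨X, hX, hXy⟩ := Submodule.mem_map.1 hy
  change π₁.toLinearMap ∘ₗ X ∘ₗ ι₁.toLinearMap = π₁.toLinearMap ∘ₗ Y ∘ₗ ι₁.toLinearMap at hXy
  rw [eq_sum_blocks_of_mem_hodgeLie ι₁ π₁ ι₂ π₂ hπι₁ hπι₂ hsum hY, ← hXy]
  exact Submodule.add_mem _ (h1 X hX)
    (h2 _ (form_apply_add_eq_zero_of_mem_hodgeLie ψ₂ (comp_mem_hodgeLie_of_retract ι₂ π₂ hπι₂ hY)))

end HodgeStructure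

end Literature.AlgebraicGeometry.Motives

end
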